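import Literature.Topology.PlanarFoliations.WalkFence
import HarnessLib

/-!
# The plane band of a walk fence

Topic: Topology / PlanarFoliations, sequel to `WalkFence.lean` (the walk fence `walkFence n` of a
walk of the separatrix graph: a fence `Φ` of the ambient foliation with planar description `Ψ` on
the side `s`). For the winding-number arguments along hugged walks we need the horizontals of the
fence **as loops of the plane**, jointly continuous **up to the base level**, where the tracked
planar leaf paths degenerate to the planar trace of the walk (through the punctures, which are not
points of `X`). So we define by the same recursion the **plane band**
`walkPlaneBand n : I → ℝ → ℂ` — gates read through the star coordinates `pt` (which make sense at
the puncture), edges through `ι ∘ Ψ` of the chosen edge fences — and prove: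

* `walkPlaneBand_eq_ι` (**proved**): at the levels on the side `s` the plane band is `ι ∘ Ψ` (the
  image of the tracked planar leaf path);
* `continuousOn_walkPlaneBand` (**proved**): it is jointly continuous on `I × [τ₀, τ₀ ± ε)` (the
  closed side `s` half-interval, base level included);
* `walkPlaneBand_base` (**proved**): at the base level it is the **planar trace** `walkPlaneBase`
  of the walk (prong in, puncture, prong out, then `ι ∘ link`), and `walkBase = g ∘ walkPlaneBase`
  (`walkBase_eq`).

Also the generic joint continuity of concatenated fences (`continuousOn_uncurry_transFence`).

## References

* C. Camacho, A. Lins Neto, *Geometric Theory of Foliations*, Birkhäuser (1985), Ch. VII §2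
  [CamachoLinsNeto1985].
-/

noncomputable section

open Set Filter Function Metric unitInterval
open _root_.Topology
open Literature.Topology.FourManifolds Literature.Topology.FourManifolds.Foliation

namespace Literature.Topology.PlanarFoliations

/-! ## Joint continuity of concatenated fences -/

section TransFence

variable {Y : Type*} [TopologicalSpace Y] {Φ₁ Φ₂ : I → ℝ → Y} {J : Set ℝ}

/-- **A concatenated fence is jointly continuous** on `I × J` when the pieces are and their
junction verticals agree on `J`. [folklore] -/
theorem continuousOn_uncurry_transFence (h₁ : ContinuousOn (uncurry Φ₁) (univ ×ˢ J)) (h₂ : ContinuousOn (uncurry Φ₂) (univ ×ˢ J))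
    (hjoin : ∀ τ ∈ J, Φ₁ 1 τ = Φ₂ 0 τ) : ContinuousOn (uncurry (transFence Φ₁ Φ₂)) (univ ×ˢ J) := by
  have hc : ContinuousOn (fun p : I × ℝ ↦ if ((p.1 : I) : ℝ) ≤ 1 / 2 then uncurry Φ₁ (fstHalf p.1, p.2)
      else uncurry Φ₂ (sndHalf p.1, p.2)) (univ ×ˢ J) := by
    refine ContinuousOn.if ?_ ?_ ?_
    · rintro ⟨θ, τ⟩ ⟨⟨-, hτ⟩, hfr⟩
      have hclosed : IsClosed {p : I × ℝ | ((p.1 : I) : ℝ) ≤ 1 / 2} :=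
        isClosed_le (continuous_subtype_val.comp continuous_fst) continuous_const
      have hclosed' : IsClosed {p : I × ℝ | 1 / 2 ≤ ((p.1 : I) : ℝ)} :=
        isClosed_le continuous_const (continuous_subtype_val.comp continuous_fst)
      have h1 : (θ : ℝ) ≤ 1 / 2 := hclosed.closure_subset (frontier_subset_closure hfr)
      have h2 : 1 / 2 ≤ (θ : ℝ) := by
        have hcl : (θ, τ) ∈ closure ({p : I × ℝ | ((p.1 : I) : ℝ) ≤ 1 / 2}ᶜ) := by
          rw [closure_compl]; exact hfr.2
        have hsub : ({p : I × ℝ | ((p.1 : I) : ℝ) ≤ 1 / 2}ᶜ) ⊆ {p : I × ℝ | 1 / 2 ≤ ((p.1 : I) : ℝ)} :=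
          fun p hp ↦ by
            simp only [mem_compl_iff, mem_setOf_eq, not_le] at hp
            exact hp.le
        exact hclosed'.closure_subset (closure_mono hsub hcl)
      have hθ : (θ : ℝ) = 1 / 2 := le_antisymm h1 h2
      simp only [uncurry, fstHalf_eq_one hθ, sndHalf_eq_zero hθ]
      exact hjoin τ hτ
    · exact h₁.comp (continuous_fstHalf.prodMap continuous_id).continuousOn fun p hp ↦ ⟨mem_univ _, hp.1.2⟩
    · exact h₂.comp (continuous_sndHalf.prodMap continuous_id).continuousOn fun p hp ↦ ⟨mem_univ _, hp.1.2⟩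
  refine hc.congr ?_
  rintro ⟨θ, τ⟩ -
  simp only [uncurry, transFence]
  split_ifs <;> rfl

end TransFence

variable {X : Type*} [TopologicalSpace X] [Nonempty X] {F : Foliation ℝ X} {ι : X → ℂ}
variable {B : Type*} [NormedAddCommGroup B] [NormedSpace ℝ B] {M : Type*} [TopologicalSpace M]
  {T : Foliation B M} {g : ℂ → M}

namespace StarData

variable (D : StarData F ι T g) (hι : IsOpenEmbedding ι) {v : ℂ} (hv : D.nprong v ≠ 0)

/-! ## The plane band of a gate -/

/-- **The plane band of the gate** at `v` from the prong `j` to the prong `j'` at the parameter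
`β₀`: at the level `τ` the sector coordinates at height `χ τ`, from `b = β₀` to the axis in
`S j`, then from the axis to `b = β₀` in `S j'` (through the puncture at the base level).
[folklore] -/
def gatePlane (j j' : ZMod (D.nprong v)) (β₀ : ℝ) (χ : ℝ ≃o ℝ) : I → ℝ → ℂ :=
  transFence (transFence (fun θ τ ↦ (D.star v hv).pt j (βline β₀ 0 θ, χ τ)) (fun _ τ ↦ (D.star v hv).pt j (0, χ τ)))
    (fun θ τ ↦ (D.star v hv).pt j' (βline 0 β₀ θ, χ τ))

/-- **The planar trace of the gate at the base level**: the prong `j` from `pt j (β₀, 0)` to the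
puncture, the puncture, the prong `j'` back out to `pt j' (β₀, 0)`. [folklore] -/
def gatePlaneBase (j j' : ZMod (D.nprong v)) (β₀ : ℝ) : I → ℂ :=
  transFun (transFun (fun θ ↦ (D.star v hv).pt j (βline β₀ 0 θ, 0)) (fun _ ↦ v))
    (fun θ ↦ (D.star v hv).pt j' (βline 0 β₀ θ, 0))

variable {j j' : ZMod (D.nprong v)} {β₀ : ℝ} {χ : ℝ ≃o ℝ} {τ : ℝ}

omit [Nonempty X] [NormedSpace ℝ B] in
/-- At the base level the plane band of the gate is the planar trace of the gate. [folklore] -/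
theorem gatePlane_base {τ₀ : ℝ} (hχ : χ τ₀ = 0) (θ : I) : D.gatePlane hv j j' β₀ χ θ τ₀ = D.gatePlaneBase hv j j' β₀ θ := by
  rw [gatePlane, gatePlaneBase]
  simp only [transFence_apply_eq_transFun]
  refine transFun_congr (fun θ' ↦ transFun_congr (fun θ'' ↦ by simp only [hχ]) (fun θ'' ↦ ?_) θ') (fun θ' ↦ by simp only [hχ]) θ
  show (D.star v hv).pt j (0, χ τ₀) = v
  rw [hχ, Prod.mk_zero_zero, ProngStar.pt_zero]

omit [NormedSpace ℝ B] in
/-- **On the band side the plane band of the gate is the image of the planar gate path.**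
[folklore] -/
theorem gatePlane_eq_ι_gateΨ (hβ₀ : β₀ ∈ Icc 0 (D.star v hv).ρ) (hh : χ τ ∈ Icc (-(D.star v hv).ρ) (D.star v hv).ρ)
    (hh0 : χ τ ≠ 0) (θ : I) : D.gatePlane hv j j' β₀ χ θ τ = ι (D.gateΨ hι hv j j' β₀ χ θ τ) := by
  have h0 : (0 : ℝ) ∈ Icc 0 (D.star v hv).ρ := ⟨le_rfl, (D.star v hv).ρ_pos.le⟩
  have hrect : ∀ {β : ℝ}, β ∈ Icc 0 (D.star v hv).ρ → (β, χ τ) ∈ (D.star v hv).rect := fun hβ ↦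
    ((D.star v hv).mem_rect_iff).2 ⟨hβ, hh⟩
  have hne : ∀ β : ℝ, ((β, χ τ) : ℝ × ℝ) ≠ 0 := fun β h ↦ hh0 (by simpa using congrArg Prod.snd h)
  show D.gatePlane hv j j' β₀ χ θ τ = ι (D.gateΨ hι hv j j' β₀ χ θ τ)
  rw [gatePlane, gateΨ]
  simp only [← transFence_map ι]
  refine transFence_congr (fun θ' ↦ transFence_congr (fun θ'' ↦ ?_) (fun θ'' ↦ ?_) θ') (fun θ' ↦ ?_) θ
  · exact ((D.star v hv).ι_horiz hι (hrect (βline_mem hβ₀ h0 θ'')) (hne _)).symm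
  · exact ((D.star v hv).ι_horiz hι (hrect h0) (hne _)).symm
  · exact ((D.star v hv).ι_horiz hι (hrect (βline_mem h0 hβ₀ θ')) (hne _)).symm

omit [Nonempty X] [NormedSpace ℝ B] in
/-- **The plane band of the gate is jointly continuous on the closed band side**: on the levels
`τ` with `χ τ ∈ [-ρ, ρ]` at which the second prong is the neighbour of the first or `χ τ = 0`.
[folklore] -/
theorem continuousOn_gatePlane (hβ₀ : β₀ ∈ Icc 0 (D.star v hv).ρ) {J : Set ℝ}
    (hJ : ∀ τ ∈ J, χ τ ∈ Icc (-(D.star v hv).ρ) (D.star v hv).ρ)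
    (hnb : ∀ τ ∈ J, χ τ = 0 ∨ j' = (D.star v hv).nb j (χ τ)) :
    ContinuousOn (uncurry (D.gatePlane hv j j' β₀ χ)) (univ ×ˢ J) := by
  set P := D.star v hv with hP
  have h0 : (0 : ℝ) ∈ Icc 0 P.ρ := ⟨le_rfl, P.ρ_pos.le⟩
  have hrect : ∀ {β : ℝ} {τ : ℝ}, β ∈ Icc 0 P.ρ → τ ∈ J → (β, χ τ) ∈ P.rect := fun hβ hτ ↦
    (P.mem_rect_iff).2 ⟨hβ, hJ _ hτ⟩
  -- the three pieces are jointly continuous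
  have hpiece : ∀ (k : ZMod (D.nprong v)) {βa βb : ℝ}, βa ∈ Icc 0 P.ρ → βb ∈ Icc 0 P.ρ →
      ContinuousOn (uncurry fun (θ : I) (τ : ℝ) ↦ P.pt k (βline βa βb θ, χ τ)) (univ ×ˢ J) := by
    intro k βa βb ha hb
    have hc : Continuous fun p : I × ℝ ↦ ((βline βa βb p.1, χ p.2) : ℝ × ℝ) :=
      ((continuous_βline βa βb).comp continuous_fst).prodMk (χ.continuous.comp continuous_snd)
    exact (P.continuousOn_pt k).comp hc.continuousOn fun p hp ↦ hrect (βline_mem ha hb p.1) hp.2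
  have hmid : ContinuousOn (uncurry fun (_ : I) (τ : ℝ) ↦ P.pt j (0, χ τ)) (univ ×ˢ J) := by
    have hc : Continuous fun p : I × ℝ ↦ (((0 : ℝ), χ p.2) : ℝ × ℝ) := continuous_const.prodMk (χ.continuous.comp continuous_snd)
    exact (P.continuousOn_pt j).comp hc.continuousOn fun p hp ↦ hrect h0 hp.2
  refine continuousOn_uncurry_transFence (continuousOn_uncurry_transFence (hpiece j hβ₀ h0) hmid fun τ _ ↦ ?_)
    (hpiece j' h0 hβ₀) fun τ hτ ↦ ?_
  · show P.pt j (βline β₀ 0 1, χ τ) = P.pt j (0, χ τ); rw [βline_one]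
  · rw [transFence_one]
    show P.pt j (0, χ τ) = P.pt j' (βline 0 β₀ 0, χ τ)
    rw [βline_zero]
    rcases hnb τ hτ with h | h
    · rw [h, Prod.mk_zero_zero, ProngStar.pt_zero, ProngStar.pt_zero]
    · rw [h, P.pt_nb_zero (hJ τ hτ)]

omit [Nonempty X] [NormedSpace ℝ B] in
/-- The plane band of the gate at `θ = 0`. [folklore] -/
theorem gatePlane_zero (τ : ℝ) : D.gatePlane hv j j' β₀ χ 0 τ = (D.star v hv).pt j (β₀, χ τ) := by
  rw [gatePlane, transFence_zero, transFence_zero]; show (D.star v hv).pt j (βline β₀ 0 0, χ τ) = _; rw [βline_zero]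

omit [Nonempty X] [NormedSpace ℝ B] in
/-- The plane band of the gate at `θ = 1`. [folklore] -/
theorem gatePlane_one (τ : ℝ) : D.gatePlane hv j j' β₀ χ 1 τ = (D.star v hv).pt j' (β₀, χ τ) := by
  rw [gatePlane, transFence_one]; show (D.star v hv).pt j' (βline 0 β₀ 1, χ τ) = _; rw [βline_one]

omit [NormedSpace ℝ B] in
/-- The gate fence is `g` of the plane band of the gate, at the base level. [folklore] -/
theorem gateBase_eq (J₀ : D.WalkJunction hι) (θ : I) : J₀.gateBase θ = g (D.gatePlaneBase J₀.hv J₀.jin J₀.jout J₀.β θ) := by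
  rw [WalkJunction.gateBase, gatePlaneBase]
  simp only [← transFun_map g]

/-! ## The plane band of the walk fence -/

section Walk

variable {D hι}
variable (ho : F.IsTransverselyOriented) {J : ℕ → D.WalkJunction hι}
  {ℓ : ∀ k, Path (J k).Kout.base (J (k + 1)).Kin.base} (hℓ : ∀ k, Continuous (toLeafSpace ∘ ℓ k : I → F.LeafSpace))
  {s : ℝ} (hs : s = 1 ∨ s = -1) (hturn : ∀ k, (J k).jout = (J k).turn s)

/-- **The planar trace of the walk** up to the junction `n` (through the punctures). [folklore] -/
def walkPlaneBase (J : ℕ → D.WalkJunction hι) (ℓ : ∀ k, Path (J k).Kout.base (J (k + 1)).Kin.base) : ℕ → I → ℂ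
  | 0 => fun _ ↦ (D.star (J 0).v (J 0).hv).pt (J 0).jin ((J 0).β, 0)
  | n + 1 => transFun (transFun (walkPlaneBase J ℓ n) (D.gatePlaneBase (J n).hv (J n).jin (J n).jout (J n).β))
      (fun θ ↦ ι (transFun (transFun (fun _ ↦ (J n).Kout.base) (ℓ n)) (fun _ ↦ (J (n + 1)).Kin.base) θ))

omit [NormedSpace ℝ B] in
/-- **The base horizontal of the walk fence is `g` of the planar trace.** [folklore] -/
theorem walkBase_eq (n : ℕ) (θ : I) : D.walkBase J ℓ n θ = g (walkPlaneBase J ℓ n θ) := by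
  induction n generalizing θ with
  | zero => rfl
  | succ n ih =>
    show transFun (transFun (D.walkBase J ℓ n) (J n).gateBase) _ θ =
      g (transFun (transFun (walkPlaneBase J ℓ n) _) _ θ)
    simp only [← transFun_map g]
    exact transFun_congr (fun θ' ↦ transFun_congr (fun θ'' ↦ ih θ'') (fun θ'' ↦ D.gateBase_eq hι (J n) θ'') θ') (fun _ ↦ rfl) θ

/-- **The plane band of the walk fence**, by the recursion of `walkFence`. [folklore] -/
def walkPlaneBand : (n : ℕ) → I → ℝ → ℂ
  | 0 => fun _ τ ↦ (D.star (J 0).v (J 0).hv).pt (J 0).jin ((J 0).β, (J 0).χ₀ τ)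
  | n + 1 => transFence (transFence (walkPlaneBand n)
      (D.gatePlane (J n).hv (J n).jin (J n).jout (J n).β (D.walkFence ho hℓ hs hturn n).χ))
      (fun θ τ ↦ ι (((D.walkFence ho hℓ hs hturn n).edge ho hℓ).Ψ θ τ))

/-- The closed half-interval of levels on the side `s` within the radius `ε`. [folklore] -/
def sideLevels (τ₀ s ε : ℝ) : Set ℝ := {τ | τ ∈ Ioo (τ₀ - ε) (τ₀ + ε) ∧ 0 ≤ s * (τ - τ₀)}

omit [Nonempty X] in
/-- On the side levels, either `τ = τ₀` or `τ` is strictly on the side `s`. [folklore] -/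
theorem eq_or_pos_of_mem_sideLevels {τ₀ ε τ : ℝ} (hs : s = 1 ∨ s = -1) (h : τ ∈ sideLevels τ₀ s ε) :
    τ = τ₀ ∨ 0 < s * (τ - τ₀) := by
  rcases h.2.eq_or_lt with h0 | h0
  · left
    rcases hs with rfl | rfl
    · linarith
    · linarith
  · exact Or.inr h0

/-- **The properties of the plane band**: on the side levels it is `ι ∘ Ψ`; its end verticals
are the star verticals `pt jin₀ (β₀, χ₀ τ)`, `pt jinₙ (βₙ, χ τ)` at all levels; it is jointly
continuous on the closed side half-interval; at the base level it is the planar trace.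
[folklore] -/
theorem walkPlaneBand_spec (n : ℕ) :
    (∀ τ ∈ Ioo ((J 0).τ₀ - (D.walkFence ho hℓ hs hturn n).ε) ((J 0).τ₀ + (D.walkFence ho hℓ hs hturn n).ε),
        0 < s * (τ - (J 0).τ₀) → ∀ θ, walkPlaneBand ho hℓ hs hturn n θ τ = ι ((D.walkFence ho hℓ hs hturn n).Ψ θ τ)) ∧
    (∀ τ ∈ Ioo ((J 0).τ₀ - (D.walkFence ho hℓ hs hturn n).ε) ((J 0).τ₀ + (D.walkFence ho hℓ hs hturn n).ε),
        walkPlaneBand ho hℓ hs hturn n 0 τ = (D.star (J 0).v (J 0).hv).pt (J 0).jin ((J 0).β, (J 0).χ₀ τ) ∧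
        walkPlaneBand ho hℓ hs hturn n 1 τ =
          (D.star (J n).v (J n).hv).pt (J n).jin ((J n).β, (D.walkFence ho hℓ hs hturn n).χ τ)) ∧
    ContinuousOn (uncurry (walkPlaneBand ho hℓ hs hturn n))
      (univ ×ˢ sideLevels (J 0).τ₀ s (D.walkFence ho hℓ hs hturn n).ε) ∧
    (∀ θ, walkPlaneBand ho hℓ hs hturn n θ (J 0).τ₀ = walkPlaneBase J ℓ n θ) := by
  induction n with
  | zero =>
    refine ⟨fun τ hτ _ θ ↦ ((J 0).ι_T₁_χ₀ hτ).symm, fun τ _ ↦ ⟨rfl, rfl⟩, ?_, fun θ ↦ ?_⟩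
    · -- continuity: `pt` on the rectangle
      have hc : Continuous fun p : I × ℝ ↦ (((J 0).β, (J 0).χ₀ p.2) : ℝ × ℝ) :=
        continuous_const.prodMk ((J 0).χ₀.continuous.comp continuous_snd)
      exact ((D.star (J 0).v (J 0).hv).continuousOn_pt (J 0).jin).comp hc.continuousOn fun p hp ↦
        ((D.star (J 0).v (J 0).hv).mem_rect_iff).2 ⟨(J 0).hβ, (J 0).χ₀_mem hp.2.1⟩
    · show (D.star (J 0).v (J 0).hv).pt (J 0).jin ((J 0).β, (J 0).χ₀ (J 0).τ₀) = (D.star (J 0).v (J 0).hv).pt (J 0).jin ((J 0).β, 0)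
      rw [(J 0).χ₀_τ₀]
  | succ n ih =>
    obtain ⟨ihι, ihends, ihcont, ihbase⟩ := ih
    set W := D.walkFence ho hℓ hs hturn n with hW
    set E := W.edge ho hℓ with hE
    have hsucc : D.walkFence ho hℓ hs hturn (n + 1) = W.succ ho hℓ hs hturn := rfl
    -- radii
    have hε4 : (W.succ ho hℓ hs hturn).ε = W.succRadius ho hℓ / 4 := rfl
    have hεc : W.succRadius ho hℓ ≤ W.ε := min_le_left _ _
    have hεg : W.succRadius ho hℓ ≤ D.icRadius (J n).hv W.χ W.χ_apply / 4 := (min_le_right _ _).trans (min_le_left _ _)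
    have hεe : W.succRadius ho hℓ ≤ E.ε := (min_le_right _ _).trans (min_le_right _ _)
    have hεpos : 0 < W.succRadius ho hℓ / 4 := (W.succ ho hℓ hs hturn).ε_pos
    have hI : ∀ {b : ℝ}, W.succRadius ho hℓ / 4 ≤ b →
        Ioo ((J 0).τ₀ - W.succRadius ho hℓ / 4) ((J 0).τ₀ + W.succRadius ho hℓ / 4) ⊆ Ioo ((J 0).τ₀ - b) ((J 0).τ₀ + b) :=
      fun h ↦ Ioo_subset_Ioo (by linarith) (by linarith)
    have hIW : Ioo ((J 0).τ₀ - W.succRadius ho hℓ / 4) ((J 0).τ₀ + W.succRadius ho hℓ / 4) ⊆ Ioo ((J 0).τ₀ - W.ε) ((J 0).τ₀ + W.ε) :=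
      hI (by linarith)
    have hIE : Ioo ((J 0).τ₀ - W.succRadius ho hℓ / 4) ((J 0).τ₀ + W.succRadius ho hℓ / 4) ⊆ Ioo ((J 0).τ₀ - E.ε) ((J 0).τ₀ + E.ε) :=
      hI (by linarith)
    have hIg : Ioo ((J 0).τ₀ - W.succRadius ho hℓ / 4) ((J 0).τ₀ + W.succRadius ho hℓ / 4) ⊆
        Ioo ((J 0).τ₀ - D.icRadius (J n).hv W.χ W.χ_apply) ((J 0).τ₀ + D.icRadius (J n).hv W.χ W.χ_apply) :=
      hI (by linarith [D.icRadius_pos (J n).hv W.χ W.χ_apply])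
    have hχmem : ∀ τ ∈ Ioo ((J 0).τ₀ - W.succRadius ho hℓ / 4) ((J 0).τ₀ + W.succRadius ho hℓ / 4),
        W.χ τ ∈ Icc (-(D.star (J n).v (J n).hv).ρ) (D.star (J n).v (J n).hv).ρ := fun τ hτ ↦
      D.icRadius_spec (J n).hv W.χ W.χ_apply τ (hIg hτ)
    -- unfold the band at `n + 1`
    have hband : walkPlaneBand ho hℓ hs hturn (n + 1) = transFence (transFence (walkPlaneBand ho hℓ hs hturn n)
        (D.gatePlane (J n).hv (J n).jin (J n).jout (J n).β W.χ)) (fun θ τ ↦ ι (E.Ψ θ τ)) := rfl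
    rw [hband, hsucc]
    refine ⟨fun τ hτ hsτ θ ↦ ?_, fun τ hτ ↦ ⟨?_, ?_⟩, ?_, fun θ ↦ ?_⟩
    · -- side levels: the three pieces are images of the planar pieces
      obtain ⟨hspos, hne0⟩ := orderIso_sign W.χ W.χ_apply hs hsτ
      have hnb : (J n).jout = (D.star (J n).v (J n).hv).nb (J n).jin (W.χ τ) := by
        rw [hturn]; exact ((J n).nb_eq_turn hs hspos).symm
      show _ = ι (transFence (transFence (W.Ψ) (D.gateΨ hι (J n).hv (J n).jin (J n).jout (J n).β W.χ)) E.Ψ θ τ)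
      simp only [← transFence_map ι]
      refine transFence_congr (fun θ' ↦ transFence_congr (fun θ'' ↦ ihι τ (hIW hτ) hsτ θ'')
        (fun θ'' ↦ D.gatePlane_eq_ι_gateΨ hι (J n).hv (J n).hβ (hχmem τ hτ) hne0 θ'') θ') (fun θ' ↦ rfl) θ
    · rw [transFence_zero, transFence_zero]; exact (ihends τ (hIW hτ)).1
    · rw [transFence_one]
      show ι (E.Ψ 1 τ) = _
      rw [E.Ψ_one τ (hIE hτ), E.ι_T₁' τ (hIE hτ)]
      rfl
    · -- joint continuity on the closed side half-interval
      have hSsub : sideLevels (J 0).τ₀ s (W.succRadius ho hℓ / 4) ⊆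
          Ioo ((J 0).τ₀ - W.succRadius ho hℓ / 4) ((J 0).τ₀ + W.succRadius ho hℓ / 4) := fun τ hτ ↦ hτ.1
      have hSW : sideLevels (J 0).τ₀ s (W.succRadius ho hℓ / 4) ⊆ sideLevels (J 0).τ₀ s W.ε := fun τ hτ ↦ ⟨hIW hτ.1, hτ.2⟩
      have h₁ : ContinuousOn (uncurry (walkPlaneBand ho hℓ hs hturn n)) (univ ×ˢ sideLevels (J 0).τ₀ s (W.succRadius ho hℓ / 4)) :=
        ihcont.mono (prod_mono Subset.rfl hSW)
      have h₂ : ContinuousOn (uncurry (D.gatePlane (J n).hv (J n).jin (J n).jout (J n).β W.χ))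
          (univ ×ˢ sideLevels (J 0).τ₀ s (W.succRadius ho hℓ / 4)) := by
        refine D.continuousOn_gatePlane (J n).hv (J n).hβ (fun τ hτ ↦ hχmem τ (hSsub hτ)) fun τ hτ ↦ ?_
        rcases eq_or_pos_of_mem_sideLevels hs hτ with h | h
        · exact Or.inl (by rw [h]; exact W.χ_apply)
        · obtain ⟨hspos, -⟩ := orderIso_sign W.χ W.χ_apply hs h
          exact Or.inr (by rw [hturn]; exact ((J n).nb_eq_turn hs hspos).symm)
      have h₃ : ContinuousOn (uncurry fun θ τ ↦ ι (E.Ψ θ τ)) (univ ×ˢ sideLevels (J 0).τ₀ s (W.succRadius ho hℓ / 4)) :=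
        E.continuousOn_ιΨ.mono (prod_mono Subset.rfl (hSsub.trans hIE))
      refine continuousOn_uncurry_transFence (continuousOn_uncurry_transFence h₁ h₂ fun τ hτ ↦ ?_) h₃ fun τ hτ ↦ ?_
      · rw [(ihends τ (hIW (hSsub hτ))).2, gatePlane_zero]
      · rw [transFence_one, gatePlane_one]
        show _ = ι (E.Ψ 0 τ)
        rw [E.Ψ_zero τ (hIE (hSsub hτ)), E.ι_T₁ τ (hIE (hSsub hτ))]
    · -- the base level
      show _ = transFun (transFun (walkPlaneBase J ℓ n) (D.gatePlaneBase (J n).hv (J n).jin (J n).jout (J n).β))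
        (fun θ ↦ ι (transFun (transFun (fun _ ↦ (J n).Kout.base) (ℓ n)) (fun _ ↦ (J (n + 1)).Kin.base) θ)) θ
      simp only [transFence_apply_eq_transFun]
      refine transFun_congr (fun θ' ↦ transFun_congr (fun θ'' ↦ ihbase θ'') (fun θ'' ↦ D.gatePlane_base (J n).hv W.χ_apply θ'') θ')
        (fun θ' ↦ ?_) θ
      show ι (E.Ψ θ' (J 0).τ₀) = _
      rw [E.Ψ_base]

/-- **On the side levels the plane band is the image of the tracked planar leaf path.**
[folklore] -/
theorem walkPlaneBand_eq_ι (n : ℕ) {τ : ℝ}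
    (hτ : τ ∈ Ioo ((J 0).τ₀ - (D.walkFence ho hℓ hs hturn n).ε) ((J 0).τ₀ + (D.walkFence ho hℓ hs hturn n).ε))
    (hsτ : 0 < s * (τ - (J 0).τ₀)) (θ : I) :
    walkPlaneBand ho hℓ hs hturn n θ τ = ι ((D.walkFence ho hℓ hs hturn n).Ψ θ τ) :=
  (walkPlaneBand_spec ho hℓ hs hturn n).1 τ hτ hsτ θ

/-- **The plane band is jointly continuous on the closed side half-interval of levels.**
[folklore] -/
theorem continuousOn_walkPlaneBand (n : ℕ) :
    ContinuousOn (uncurry (walkPlaneBand ho hℓ hs hturn n)) (univ ×ˢ sideLevels (J 0).τ₀ s (D.walkFence ho hℓ hs hturn n).ε) :=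
  (walkPlaneBand_spec ho hℓ hs hturn n).2.2.1

/-- **At the base level the plane band is the planar trace of the walk.** [folklore] -/
theorem walkPlaneBand_base (n : ℕ) (θ : I) : walkPlaneBand ho hℓ hs hturn n θ (J 0).τ₀ = walkPlaneBase J ℓ n θ :=
  (walkPlaneBand_spec ho hℓ hs hturn n).2.2.2 θ

/-- The end verticals of the plane band. [folklore] -/
theorem walkPlaneBand_ends (n : ℕ) {τ : ℝ}
    (hτ : τ ∈ Ioo ((J 0).τ₀ - (D.walkFence ho hℓ hs hturn n).ε) ((J 0).τ₀ + (D.walkFence ho hℓ hs hturn n).ε)) :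
    walkPlaneBand ho hℓ hs hturn n 0 τ = (D.star (J 0).v (J 0).hv).pt (J 0).jin ((J 0).β, (J 0).χ₀ τ) ∧
      walkPlaneBand ho hℓ hs hturn n 1 τ = (D.star (J n).v (J n).hv).pt (J n).jin ((J n).β, (D.walkFence ho hℓ hs hturn n).χ τ) :=
  (walkPlaneBand_spec ho hℓ hs hturn n).2.1 τ hτ

/-- **The walk fence is `g` of the plane band on the closed side half-interval.** [folklore] -/
theorem walkFence_Φ_eq (n : ℕ) {τ : ℝ} (hτ : τ ∈ sideLevels (J 0).τ₀ s (D.walkFence ho hℓ hs hturn n).ε) (θ : I) :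
    (D.walkFence ho hℓ hs hturn n).Φ θ τ = g (walkPlaneBand ho hℓ hs hturn n θ τ) := by
  rcases eq_or_pos_of_mem_sideLevels hs hτ with h | h
  · rw [h, (D.walkFence ho hℓ hs hturn n).Φ_base θ, walkPlaneBand_base, walkBase_eq]
  · rw [((D.walkFence ho hℓ hs hturn n).track τ hτ.1 h).1 θ, walkPlaneBand_eq_ι ho hℓ hs hturn n hτ.1 h]

end Walk

end StarData

end Literature.Topology.PlanarFoliations
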